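import Mathlib.Analysis.SpecialFunctions.SmoothTransition
import Mathlib.MeasureTheory.Covering.DensityTheorem
import Mathlib.MeasureTheory.Measure.Lebesgue.EqHaar
import Literature.Analysis.FluidPDE.SuitableWeakPressure
import Literature.Analysis.FluidPDE.NSSuitableESSProofs
import HarnessLib

/-!
# The local energy inequality at almost every time slice

Analysis/FluidPDE support file (serves the decomposition of the ε-regularity criterion
`Literature.Analysis.FluidPDE.ckn_epsilon_regularity`, Caffarelli–Kohn–Nirenberg 1982, Prop. 2,
through the local-energy estimate `Literature.Analysis.FluidPDE.localEnergyEstimate`).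

The accepted structure `Fluid.IsSuitableWeakSolutionOn Q ν f u p` (`FluidPDE/SuitableWeak`;
Caffarelli–Kohn–Nirenberg 1982, (2.5); Lin 1998, Def. 1) records the local energy inequality in
its **integrated** form: for every nonnegative `φ ∈ C_c^∞(Q)`,
`2ν ∫∫ |∇u|² φ ≤ ∫∫ (|u|² (φₜ + νΔφ) + (|u|² + 2p) u·∇φ + 2 (f·u) φ)`.
The partial-regularity arguments use it in the **sliced** form (Caffarelli–Kohn–Nirenberg 1982,
(2.5′)/(2.10); Robinson–Rodrigo–Sadowski 2016, (15.8) and p. 241: "for every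
`t ∈ (-(θr)², 0)`, `∫_{B} |u(t)|² φ(t) + 2 ∫_{-1}^t ∫ |∇u|² φ ≤ ∫_{-1}^t ∫ …`"), which controls the
energy `sup_t ∫ |u(t)|² φ(t)` and not only the dissipation. This file derives the sliced form for
almost every time `s`:

* `IsSuitableWeakSolutionOn.ae_localEnergy_slice` — for a.e. `s`,
  `∫ |u(s)|² φ(s) dx + 2ν ∫∫_{t<s} |G|² φ ≤ ∫∫_{t<s} (|u|²(φₜ + νΔφ) + (|u|² + 2p) u·∇φ + 2 f·u φ)`,
  for every weak spatial gradient `G` of `u` on `Q`, under the local integrability of `|u|³` and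
  of `f·u` on `Q` (which makes the right-hand side a genuine integral; for the solutions of
  Caffarelli–Kohn–Nirenberg both hold, `u ∈ L^{10/3}_{loc}`, `f ∈ L^q_{loc}`, `q > 5/2`).

## Proof

Test the integrated inequality with `η_ε(t) φ(t, x)`, where `η_ε` is a smooth non-increasing
time cut-off equal to `1` for `t ≤ s - 2ε` and to `0` for `t ≥ s - ε/2` (built from Mathlib's
`Real.smoothTransition`, `exists_time_cutoff`): since `∂ₜ(η_ε φ) = η_ε φₜ - k_ε φ` with
`k_ε = -η_ε' ≥ 0` of unit mass, supported in `[s - 2ε, s - ε/2]` and bounded by `C/ε`, the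
inequality reads `∫ k_ε(t) U(t) dt + 2ν ∫∫ η_ε |G|² φ ≤ ∫∫ η_ε R` with
`U(t) = ∫ |u(t)|² φ(t) dx` and `R` the right-hand integrand. As `ε → 0`, `η_ε → 1_{t<s}`
(dominated convergence), and `∫ k_ε U → U(s)` at every Lebesgue point `s` of the integrable
function `U` (Mathlib's `IsUnifLocDoublingMeasure.ae_tendsto_average_norm_sub`, with moving
centres `s - 5ε/4` and radii `3ε/4`). The weak gradient of the structure is replaced by any other
one through a.e. uniqueness (`HasWeakSpatialGradientOn.ae_eq`).

## References

* L. Caffarelli, R. Kohn, L. Nirenberg, *Partial regularity of suitable weak solutions of the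
  Navier–Stokes equations*, Comm. Pure Appl. Math. 35 (1982), 771–831, §2, (2.5).
* J. C. Robinson, J. L. Rodrigo, W. Sadowski, *The three-dimensional Navier–Stokes equations*,
  Cambridge Studies in Advanced Mathematics 157 (2016), (15.8), Lemma 15.11, p. 241.
* F. Lin, *A new proof of the Caffarelli–Kohn–Nirenberg theorem*, Comm. Pure Appl. Math. 51
  (1998), 241–257, Def. 1 and (2.4).
-/

noncomputable section

open MeasureTheory Set Function Filter Topology TopologicalSpace Metric
open scoped NNReal ENNReal InnerProductSpace RealInnerProductSpace Laplacian

namespace Literature.Analysis.FluidPDE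

/-! ### Smooth non-increasing time cut-offs -/

section Cutoff

/-- The derivative of Mathlib's smooth transition function vanishes off `[0, 1]`. [folklore] -/
theorem deriv_smoothTransition_eq_zero {x : ℝ} (hx : x ∉ Icc (0 : ℝ) 1) :
    deriv Real.smoothTransition x = 0 := by
  rcases not_and_or.1 (fun h => hx ⟨h.1, h.2⟩) with h | h
  · have h' : x < 0 := not_le.1 h
    have : Real.smoothTransition =ᶠ[𝓝 x] fun _ => (0 : ℝ) := by
      filter_upwards [Iio_mem_nhds h'] with y hy
      exact Real.smoothTransition.zero_of_nonpos hy.le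
    rw [this.deriv_eq, deriv_const]
  · have h' : 1 < x := not_le.1 h
    have : Real.smoothTransition =ᶠ[𝓝 x] fun _ => (1 : ℝ) := by
      filter_upwards [Ioi_mem_nhds h'] with y hy
      exact Real.smoothTransition.one_of_one_le hy.le
    rw [this.deriv_eq, deriv_const]

/-- **Smooth time cut-offs concentrating to the left of a given time.** There is an absolute
constant `C` such that for every `s` and `ε > 0` there are smooth `η, k : ℝ → ℝ` with
`0 ≤ η ≤ 1`, `η = 1` on `(-∞, s - 2ε]`, `η = 0` on `[s - ε/2, ∞)`, `η' = -k`, `|k| ≤ C/ε`,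
`k` supported in `[s - 2ε, s - ε/2]`, and `∫ k = 1` (take `η(t) = ψ((s - ε/2 - t)/(3ε/2))` with
`ψ` Mathlib's `Real.smoothTransition`; Robinson–Rodrigo–Sadowski 2016, proof of Lemma 15.11,
the cut-off `η`). [folklore] -/
theorem exists_time_cutoff :
    ∃ C : ℝ, 0 ≤ C ∧ ∀ s ε : ℝ, 0 < ε → ∃ η k : ℝ → ℝ,
      ContDiff ℝ (⊤ : ℕ∞) η ∧ (∀ t, 0 ≤ η t ∧ η t ≤ 1) ∧ (∀ t, t ≤ s - 2 * ε → η t = 1) ∧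
      (∀ t, s - ε / 2 ≤ t → η t = 0) ∧ (∀ t, HasDerivAt η (-k t) t) ∧ Continuous k ∧
      (∀ t, |k t| ≤ C / ε) ∧ (∀ t, k t ≠ 0 → t ∈ Icc (s - 2 * ε) (s - ε / 2)) ∧
      ∫ t, k t = 1 := by
  set ψ := Real.smoothTransition with hψdef
  have hψ : ContDiff ℝ (⊤ : ℕ∞) ψ := Real.smoothTransition.contDiff
  have hψd : ∀ x, HasDerivAt ψ (deriv ψ x) x := fun x =>
    ((hψ.differentiable (by simp)).differentiableAt).hasDerivAt
  have hψc : Continuous (deriv ψ) := hψ.continuous_deriv (by simp)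
  have hψ0 : ∀ x ∉ Icc (0 : ℝ) 1, deriv ψ x = 0 := fun x hx => deriv_smoothTransition_eq_zero hx
  obtain ⟨C, hC⟩ := hψc.bounded_above_of_compact_support (HasCompactSupport.intro isCompact_Icc hψ0)
  have hC0 : 0 ≤ C := (norm_nonneg _).trans (hC 0)
  refine ⟨C, hC0, fun s ε hε => ?_⟩
  -- the affine change of variable `a(t) = (s - ε/2 - t) · (2 / (3ε))`
  set m : ℝ := 2 / (3 * ε) with hm
  have hm0 : 0 < m := by positivity
  set a : ℝ → ℝ := fun t => (s - ε / 2 - t) * m with ha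
  have had : ∀ t, HasDerivAt a (-1 * m) t := fun t => by
    simpa using ((hasDerivAt_id t).const_sub (s - ε / 2)).mul_const m
  set η : ℝ → ℝ := fun t => ψ (a t) with hη
  set k : ℝ → ℝ := fun t => deriv ψ (a t) * m with hk
  have hηd : ∀ t, HasDerivAt η (-k t) t := fun t => by
    have := (hψd (a t)).comp t (had t)
    exact this.congr_deriv (by rw [hk]; ring)
  have hma : (3 * ε / 2) * m = 1 := by rw [hm]; field_simp
  have ha1 : ∀ t, t ≤ s - 2 * ε → 1 ≤ a t := fun t ht => by
    rw [ha]; dsimp only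
    calc (1 : ℝ) = (3 * ε / 2) * m := hma.symm
      _ ≤ (s - ε / 2 - t) * m := mul_le_mul_of_nonneg_right (by linarith) hm0.le
  have ha0 : ∀ t, s - ε / 2 ≤ t → a t ≤ 0 := fun t ht => by
    rw [ha]; dsimp only
    exact mul_nonpos_of_nonpos_of_nonneg (by linarith) hm0.le
  have hk0 : ∀ t, k t ≠ 0 → t ∈ Icc (s - 2 * ε) (s - ε / 2) := by
    intro t ht
    have h1 : deriv ψ (a t) ≠ 0 := fun h => ht (by rw [hk]; dsimp only; rw [h, zero_mul])
    have h2 : a t ∈ Icc (0 : ℝ) 1 := by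
      by_contra h; exact h1 (hψ0 _ h)
    rw [ha] at h2
    dsimp only at h2
    constructor
    · have h3 : s - ε / 2 - t ≤ 3 * ε / 2 := by
        by_contra h'
        have h'' : 3 * ε / 2 < s - ε / 2 - t := not_le.1 h'
        have : (1 : ℝ) < (s - ε / 2 - t) * m := by
          calc (1 : ℝ) = (3 * ε / 2) * m := hma.symm
            _ < (s - ε / 2 - t) * m := mul_lt_mul_of_pos_right h'' hm0
        linarith [h2.2]
      linarith
    · have h3 : 0 ≤ s - ε / 2 - t := by
        by_contra h'
        have h'' : s - ε / 2 - t < 0 := not_le.1 h'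
        have : (s - ε / 2 - t) * m < 0 := mul_neg_of_neg_of_pos h'' hm0
        linarith [h2.1]
      linarith
  refine ⟨η, k, hψ.comp ((contDiff_const.sub contDiff_id).mul contDiff_const), fun t =>
    ⟨Real.smoothTransition.nonneg _, Real.smoothTransition.le_one _⟩,
    fun t ht => Real.smoothTransition.one_of_one_le (ha1 t ht),
    fun t ht => Real.smoothTransition.zero_of_nonpos (ha0 t ht), hηd,
    (hψc.comp ((continuous_const.sub continuous_id).mul continuous_const)).mul continuous_const,
    fun t => ?_, hk0, ?_⟩
  · -- `|k| ≤ C / ε`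
    rw [hk]; dsimp only
    rw [abs_mul, abs_of_pos hm0]
    have h1 : |deriv ψ (a t)| ≤ C := by simpa [Real.norm_eq_abs] using hC (a t)
    calc |deriv ψ (a t)| * m ≤ C * m := by gcongr
      _ ≤ C / ε := by
          rw [hm, div_eq_mul_one_div C ε]
          refine mul_le_mul_of_nonneg_left ?_ hC0
          rw [div_le_div_iff₀ (by positivity) hε]; linarith
  · -- `∫ k = 1`
    have hk_out : ∀ t, t ∉ Icc (s - 2 * ε) (s - ε / 2) → k t = 0 := fun t ht => by
      by_contra h; exact ht (hk0 t h)
    have hle : s - 2 * ε ≤ s - ε / 2 := by linarith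
    have hkc : Continuous k :=
      (hψc.comp ((continuous_const.sub continuous_id).mul continuous_const)).mul continuous_const
    rw [← setIntegral_eq_integral_of_forall_compl_eq_zero (s := Icc (s - 2 * ε) (s - ε / 2))
        fun t ht => hk_out t ht, integral_Icc_eq_integral_Ioc, ← intervalIntegral.integral_of_le hle]
    have hFTC := intervalIntegral.integral_eq_sub_of_hasDerivAt (f := η)
      (f' := fun t => -k t) (a := s - 2 * ε) (b := s - ε / 2) (fun t _ => hηd t)
      (hkc.neg.intervalIntegrable _ _)
    rw [intervalIntegral.integral_neg] at hFTC
    have e1 : η (s - ε / 2) = 0 := Real.smoothTransition.zero_of_nonpos (ha0 _ le_rfl)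
    have e2 : η (s - 2 * ε) = 1 := Real.smoothTransition.one_of_one_le (ha1 _ le_rfl)
    rw [e1, e2] at hFTC
    linarith

end Cutoff

/-! ### Lebesgue points and the concentrating kernels -/

section Lebesgue

/-- If `s` is a Lebesgue point of the integrable function `U` (in the moving-centre form of
Mathlib's `IsUnifLocDoublingMeasure.ae_tendsto_average_norm_sub`), then `∫ kₙ U → U(s)` for
kernels `kₙ` of unit mass supported in `[s - 2εₙ, s - εₙ/2]` and bounded by `C/εₙ`, `εₙ → 0⁺`.
[folklore] -/
theorem tendsto_integral_kernel_mul_of_lebesguePoint {U : ℝ → ℝ} (hU : Integrable U volume)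
    {s : ℝ}
    (hs : ∀ (w δ : ℕ → ℝ), Tendsto δ atTop (𝓝[>] 0) →
      (∀ᶠ j in atTop, s ∈ closedBall (w j) (2 * δ j)) →
      Tendsto (fun j => ⨍ y in closedBall (w j) (δ j), ‖U y - U s‖ ∂volume) atTop (𝓝 0))
    {C : ℝ} {ε : ℕ → ℝ} (hε : ∀ n, 0 < ε n) (hε0 : Tendsto ε atTop (𝓝 0))
    {k : ℕ → ℝ → ℝ} (hkc : ∀ n, Continuous (k n)) (hkb : ∀ n t, |k n t| ≤ C / ε n)
    (hks : ∀ n t, k n t ≠ 0 → t ∈ Icc (s - 2 * ε n) (s - ε n / 2))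
    (hk1 : ∀ n, ∫ t, k n t = 1) :
    Tendsto (fun n => ∫ t, k n t * U t) atTop (𝓝 (U s)) := by
  -- the balls carrying the kernels
  set w : ℕ → ℝ := fun n => s - 5 * ε n / 4 with hw
  set δ : ℕ → ℝ := fun n => 3 * ε n / 4 with hδ
  have hball : ∀ n, Icc (s - 2 * ε n) (s - ε n / 2) = closedBall (w n) (δ n) := fun n => by
    rw [Real.closedBall_eq_Icc]
    congr 1 <;> simp only [hw, hδ] <;> ring
  have hδ0 : Tendsto δ atTop (𝓝[>] 0) := by
    refine tendsto_nhdsWithin_iff.2 ⟨?_, Eventually.of_forall fun n => ?_⟩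
    · simpa using hε0.const_mul (3 / 4 : ℝ) |>.congr fun n => by simp only [hδ]; ring
    · simp only [hδ, mem_Ioi]; linarith [hε n]
  have hmem : ∀ᶠ n in atTop, s ∈ closedBall (w n) (2 * δ n) := Eventually.of_forall fun n => by
    rw [mem_closedBall, Real.dist_eq, hw, hδ]
    rw [show s - (s - 5 * ε n / 4) = 5 * ε n / 4 by ring, abs_of_pos (by linarith [hε n])]
    linarith [hε n]
  have hav := hs w δ hδ0 hmem
  -- kernel facts
  have hk0 : ∀ n t, t ∉ closedBall (w n) (δ n) → k n t = 0 := fun n t ht => by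
    by_contra h'; exact ht (hball n ▸ hks n t h')
  have hkint : ∀ n, Integrable (fun t => k n t * U t) volume := fun n =>
    hU.bdd_mul (hkc n).aestronglyMeasurable (Eventually.of_forall fun t => by
      rw [Real.norm_eq_abs]; exact hkb n t)
  have hkint' : ∀ n, Integrable (k n) volume := fun n =>
    (hkc n).integrable_of_hasCompactSupport
      (HasCompactSupport.intro (isCompact_closedBall (w n) (δ n)) (hk0 n))
  have hδpos : ∀ n, 0 < δ n := fun n => by simp only [hδ]; linarith [hε n]
  have hvol : ∀ n, (volume : Measure ℝ).real (closedBall (w n) (δ n)) = 2 * δ n := fun n => by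
    rw [measureReal_def, Real.volume_closedBall, ENNReal.toReal_ofReal (by linarith [hδpos n])]
  -- the key estimate `|∫ kₙ U - U s| ≤ (3C/2) ⨍_{ball} |U - U s|`
  have key : ∀ n, |(∫ t, k n t * U t) - U s| ≤
      (3 * C / 2) * ⨍ y in closedBall (w n) (δ n), ‖U y - U s‖ := by
    intro n
    set B := closedBall (w n) (δ n) with hB
    have hBc : IsCompact B := isCompact_closedBall _ _
    have hconst : IntegrableOn (fun _ : ℝ => U s) B volume :=
      continuousOn_const.integrableOn_compact hBc
    have hdiff : IntegrableOn (fun t => ‖U t - U s‖) B volume := (hU.integrableOn.sub hconst).norm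
    have h1 : (∫ t, k n t * U t) - U s = ∫ t, k n t * (U t - U s) := by
      have e : (fun t => k n t * (U t - U s)) = fun t => k n t * U t - k n t * U s := by
        funext t; ring
      rw [e, integral_sub (hkint n) ((hkint' n).mul_const _), integral_mul_const, hk1 n, one_mul]
    have h2 : |∫ t, k n t * (U t - U s)| ≤ (C / ε n) * ∫ t in B, ‖U t - U s‖ := by
      calc |∫ t, k n t * (U t - U s)| ≤ ∫ t, ‖k n t * (U t - U s)‖ := by
            rw [← Real.norm_eq_abs]; exact norm_integral_le_integral_norm _
        _ ≤ ∫ t, B.indicator (fun t => (C / ε n) * ‖U t - U s‖) t := by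
            have hb : IntegrableOn (fun t => (C / ε n) * ‖U t - U s‖) B volume :=
              hdiff.const_mul _
            refine integral_mono_of_nonneg (Eventually.of_forall fun t => norm_nonneg _)
              (hb.integrable_indicator measurableSet_closedBall)
              (Eventually.of_forall fun t => ?_)
            dsimp only
            by_cases ht : t ∈ B
            · rw [indicator_of_mem ht, norm_mul, Real.norm_eq_abs]
              exact mul_le_mul_of_nonneg_right (hkb n t) (norm_nonneg _)
            · rw [indicator_of_notMem ht, hk0 n t ht, zero_mul, norm_zero]
        _ = (C / ε n) * ∫ t in B, ‖U t - U s‖ := by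
            rw [integral_indicator measurableSet_closedBall, integral_const_mul]
    have h3 : ∫ t in B, ‖U t - U s‖ = (2 * δ n) * ⨍ y in B, ‖U y - U s‖ := by
      rw [setAverage_eq, smul_eq_mul, hvol n, ← mul_assoc,
        mul_inv_cancel₀ (by linarith [hδpos n] : (2 : ℝ) * δ n ≠ 0), one_mul]
    rw [h1]
    calc |∫ t, k n t * (U t - U s)| ≤ (C / ε n) * ∫ t in B, ‖U t - U s‖ := h2
      _ = (C / ε n) * ((2 * δ n) * ⨍ y in B, ‖U y - U s‖) := by rw [h3]
      _ = (3 * C / 2) * ⨍ y in B, ‖U y - U s‖ := by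
          simp only [hδ]
          have : ε n ≠ 0 := (hε n).ne'
          field_simp
          ring
  refine tendsto_iff_norm_sub_tendsto_zero.2 ?_
  refine squeeze_zero (fun n => norm_nonneg _) (fun n => ?_)
    (by simpa using hav.const_mul (3 * C / 2))
  rw [Real.norm_eq_abs]
  exact key n

end Lebesgue

/-! ### The sliced local energy inequality -/

section Slice

variable {E : Type*} [NormedAddCommGroup E] [InnerProductSpace ℝ E] [FiniteDimensional ℝ E]
  [MeasurableSpace E] [BorelSpace E]

/-- Smooth time cut-offs converge pointwise to the indicator of `{t < s}`: if
`ηₙ = 1` on `(-∞, s - 2εₙ]`, `ηₙ = 0` on `[s - εₙ/2, ∞)` and `εₙ → 0⁺`, then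
`ηₙ(t) → 1_{t<s}`. [folklore] -/
theorem tendsto_cutoff_indicator {s : ℝ} {ε : ℕ → ℝ} (hε : ∀ n, 0 < ε n)
    (hε0 : Tendsto ε atTop (𝓝 0)) {η : ℕ → ℝ → ℝ} (h1 : ∀ n t, t ≤ s - 2 * ε n → η n t = 1)
    (h0 : ∀ n t, s - ε n / 2 ≤ t → η n t = 0) (t : ℝ) :
    Tendsto (fun n => η n t) atTop (𝓝 ((Iio s).indicator (fun _ => (1 : ℝ)) t)) := by
  by_cases ht : t < s
  · rw [indicator_of_mem (mem_Iio.2 ht)]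
    have hev : ∀ᶠ n in atTop, η n t = 1 := by
      have : ∀ᶠ n in atTop, ε n < (s - t) / 2 :=
        hε0.eventually (gt_mem_nhds (by linarith))
      filter_upwards [this] with n hn
      exact h1 n t (by linarith)
    exact tendsto_const_nhds.congr' (hev.mono fun n hn => hn.symm)
  · rw [indicator_of_notMem (fun h' => ht (mem_Iio.1 h'))]
    refine tendsto_const_nhds.congr fun n => (h0 n t ?_).symm
    linarith [hε n, not_lt.1 ht]

variable {Q : Opens (ℝ × E)} {ν : ℝ} {f u : ℝ → E → E} {p : ℝ → E → ℝ}
  {G : ℝ → E → E →L[ℝ] E}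

/-- The Frobenius norm squared of a weak spatial gradient with `∫_K |G|² < ∞` on compacts is
locally integrable on `Q`. [folklore] -/
theorem locallyIntegrableOn_frobeniusNormSq (hG : HasWeakSpatialGradientOn Q u G)
    (hG2 : ∀ K ⊆ (Q : Set (ℝ × E)), IsCompact K →
      ∫⁻ z in K, ENNReal.ofReal (frobeniusNormSq (G z.1 z.2)) < ∞) :
    LocallyIntegrableOn (fun z : ℝ × E => frobeniusNormSq (G z.1 z.2)) (Q : Set (ℝ × E))
      volume := by
  refine (locallyIntegrableOn_iff Q.isOpen.isLocallyClosed).2 fun K hK hKc => ?_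
  have hm : AEStronglyMeasurable (fun z : ℝ × E => frobeniusNormSq (G z.1 z.2))
      (volume.restrict K) :=
    LerayHopfProofs.continuous_frobeniusNormSq.comp_aestronglyMeasurable
      (hG.locallyIntegrableOn_grad.integrableOn_compact_subset hK hKc).aestronglyMeasurable
  refine ⟨hm, ?_⟩
  rw [hasFiniteIntegral_iff_enorm]
  refine lt_of_le_of_lt (lintegral_mono fun z => ?_) (hG2 K hK hKc)
  rw [Real.enorm_eq_ofReal (frobeniusNormSq_nonneg _)]

/-- For a suitable weak solution, `|p|^{3/2}` is integrable on every compact `K ⊆ Q`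
(the pressure class of the structure, with the measurability from `p ∈ L¹_{loc}(Q)`). [folklore] -/
theorem IsSuitableWeakSolutionOn.integrableOn_abs_pressure_rpow (h : IsSuitableWeakSolutionOn Q ν f u p)
    {K : Set (ℝ × E)} (hK : K ⊆ (Q : Set (ℝ × E))) (hKc : IsCompact K) :
    IntegrableOn (fun z : ℝ × E => |p z.1 z.2| ^ (3 / 2 : ℝ)) K volume := by
  have hp := h.distributional.2.2.1.integrableOn_compact_subset hK hKc
  have hm : AEStronglyMeasurable (fun z : ℝ × E => |p z.1 z.2| ^ (3 / 2 : ℝ)) (volume.restrict K) := by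
    have e : (fun z : ℝ × E => |p z.1 z.2| ^ (3 / 2 : ℝ)) = fun z => ‖uncurry p z‖ ^ (3 / 2 : ℝ) := by
      funext z; rw [Real.norm_eq_abs]; rfl
    rw [e]
    exact (hp.aestronglyMeasurable.aemeasurable.norm.pow_const _).aestronglyMeasurable
  refine ⟨hm, ?_⟩
  rw [hasFiniteIntegral_iff_enorm]
  refine lt_of_le_of_lt (lintegral_mono fun z => le_of_eq ?_) (h.pressure K hK hKc)
  rw [Real.enorm_eq_ofReal (Real.rpow_nonneg (abs_nonneg _) _), Real.enorm_eq_ofReal_abs,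
    ENNReal.ofReal_rpow_of_nonneg (abs_nonneg _) (by norm_num)]

/-- Under the local integrability of `|u|³`, the vector field `(|u|² + 2p) u` is locally
integrable on `Q` (Young: `|p| |u| ≤ (2/3)|p|^{3/2} + (1/3)|u|³`, with `p ∈ L^{3/2}_{loc}` from the
structure). [folklore] -/
theorem IsSuitableWeakSolutionOn.locallyIntegrableOn_cubic (h : IsSuitableWeakSolutionOn Q ν f u p)
    (hu3 : LocallyIntegrableOn (fun z : ℝ × E => ‖u z.1 z.2‖ ^ 3) (Q : Set (ℝ × E)) volume) :
    LocallyIntegrableOn (uncurry fun t x => (‖u t x‖ ^ 2 + 2 * p t x) • u t x)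
      (Q : Set (ℝ × E)) volume := by
  refine (locallyIntegrableOn_iff Q.isOpen.isLocallyClosed).2 fun K hK hKc => ?_
  have hu := h.distributional.1.integrableOn_compact_subset hK hKc
  have hp := h.distributional.2.2.1.integrableOn_compact_subset hK hKc
  have hu3K := hu3.integrableOn_compact_subset hK hKc
  have hp32 := h.integrableOn_abs_pressure_rpow hK hKc
  -- measurability
  have hm : AEStronglyMeasurable (uncurry fun t x => (‖u t x‖ ^ 2 + 2 * p t x) • u t x)
      (volume.restrict K) := by
    have e : (uncurry fun t x => (‖u t x‖ ^ 2 + 2 * p t x) • u t x) =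
        fun z : ℝ × E => (‖uncurry u z‖ ^ 2 + 2 * uncurry p z) • uncurry u z := by
      funext z; rfl
    rw [e]
    exact ((hu.aestronglyMeasurable.norm.pow 2).add
      (hp.aestronglyMeasurable.const_mul 2)).smul hu.aestronglyMeasurable
  -- domination by `(5/3)|u|³ + (4/3)|p|^{3/2}`
  refine Integrable.mono' ((hu3K.const_mul (5 / 3)).add (hp32.const_mul (4 / 3))) hm
    (Eventually.of_forall fun z => ?_)
  have hpq : (3 / 2 : ℝ).HolderConjugate 3 := Real.holderConjugate_iff.2 ⟨by norm_num, by norm_num⟩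
  have hy := Real.young_inequality_of_nonneg (abs_nonneg (p z.1 z.2)) (norm_nonneg (u z.1 z.2)) hpq
  simp only [uncurry, norm_smul, Real.norm_eq_abs, Pi.add_apply]
  have h3 : ‖u z.1 z.2‖ ^ (3 : ℝ) = ‖u z.1 z.2‖ ^ 3 := by
    rw [show (3 : ℝ) = ((3 : ℕ) : ℝ) by norm_num, Real.rpow_natCast]
  rw [h3] at hy
  have hu0 := norm_nonneg (u z.1 z.2)
  calc |‖u z.1 z.2‖ ^ 2 + 2 * p z.1 z.2| * ‖u z.1 z.2‖
      ≤ (‖u z.1 z.2‖ ^ 2 + 2 * |p z.1 z.2|) * ‖u z.1 z.2‖ := by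
        gcongr
        exact (abs_add_le _ _).trans (by rw [abs_of_nonneg (sq_nonneg _), abs_mul, abs_two])
    _ = ‖u z.1 z.2‖ ^ 3 + 2 * (|p z.1 z.2| * ‖u z.1 z.2‖) := by ring
    _ ≤ ‖u z.1 z.2‖ ^ 3 + 2 * (|p z.1 z.2| ^ (3 / 2 : ℝ) / (3 / 2) + ‖u z.1 z.2‖ ^ 3 / 3) := by
        gcongr
    _ = 5 / 3 * ‖u z.1 z.2‖ ^ 3 + 4 / 3 * |p z.1 z.2| ^ (3 / 2 : ℝ) := by ring

/-- **The local energy inequality at almost every time slice** (Caffarelli–Kohn–Nirenberg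
1982, (2.5) ⟹ the sliced form used in §2 and Lemma 5.1; Robinson–Rodrigo–Sadowski 2016, (15.8):
"`∫ |u(t)|² φ(t) + 2 ∫∫_{<t} |∇u|² φ ≤ ∫∫_{<t} |u|²(φₜ + Δφ) + (|u|² + 2p) u·∇φ`", with viscosity
`ν` and the force term `2 f·u φ` of CKN (2.5)). Let `(u, p)` be a suitable weak solution on `Q`
with `|u|³` and `f·u` locally integrable on `Q`, let `G` be any weak spatial gradient of `u` on
`Q`, and `φ ≥ 0` a space–time test function on `Q`. Then for a.e. `s`,
`∫ |u(s, x)|² φ(s, x) dx + 2ν ∫∫_{t<s} |G|² φ ≤ ∫∫_{t<s} (|u|²(φₜ + νΔφ) + (|u|² + 2p) u·∇φ + 2 f·u φ)`.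
See the file docstring for the proof. [cite: CaffarelliKohnNirenberg1982, §2 (2.5)] -/
theorem IsSuitableWeakSolutionOn.ae_localEnergy_slice (h : IsSuitableWeakSolutionOn Q ν f u p)
    (hG : HasWeakSpatialGradientOn Q u G)
    (hu3 : LocallyIntegrableOn (fun z : ℝ × E => ‖u z.1 z.2‖ ^ 3) (Q : Set (ℝ × E)) volume)
    (hfu : LocallyIntegrableOn (fun z : ℝ × E => ⟪f z.1 z.2, u z.1 z.2⟫) (Q : Set (ℝ × E)) volume)
    {φ : ℝ → E → ℝ} (hφ : IsSpaceTimeTestOn Q φ) (hφ0 : ∀ t x, 0 ≤ φ t x) :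
    ∀ᵐ s ∂(volume : Measure ℝ),
      (∫ x, ‖u s x‖ ^ 2 * φ s x) +
          2 * ν * ∫ z in {z : ℝ × E | z.1 < s}, frobeniusNormSq (G z.1 z.2) * φ z.1 z.2 ≤
        ∫ z in {z : ℝ × E | z.1 < s}, (‖u z.1 z.2‖ ^ 2 * (timeDeriv φ z.1 z.2 + ν * Δ (φ z.1) z.2) +
          (‖u z.1 z.2‖ ^ 2 + 2 * p z.1 z.2) * ⟪u z.1 z.2, gradient (φ z.1) z.2⟫ +
          2 * ⟪f z.1 z.2, u z.1 z.2⟫ * φ z.1 z.2) := by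
  -- the structure's weak gradient and local energy inequality
  obtain ⟨G₀, hG₀, hG₀2, hLEI⟩ := h.localEnergy
  set K := tsupport (uncurry φ) with hK
  have hKc : IsCompact K := hφ.hasCompactSupport
  have hKQ : K ⊆ (Q : Set (ℝ × E)) := hφ.tsupport_subset
  have hφ' : IsSpaceTimeTestOn (⊤ : Opens (ℝ × E)) φ := hφ.mono le_top
  -- continuity and support of the coefficient fields
  have hcφ : Continuous fun z : ℝ × E => φ z.1 z.2 := hφ.contDiff.continuous
  have hcT : Continuous fun z : ℝ × E => timeDeriv φ z.1 z.2 :=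
    hφ'.timeDeriv_top.contDiff.continuous
  have hcL : Continuous fun z : ℝ × E => Δ (φ z.1) z.2 := hφ'.laplacian_top.contDiff.continuous
  obtain ⟨hcg, -, hg0⟩ := hφ.continuous_gradient_field
  have hφK : ∀ z ∉ K, φ z.1 z.2 = 0 := fun z hz =>
    show uncurry φ z = 0 from image_eq_zero_of_notMem_tsupport hz
  have hTK : ∀ z ∉ K, timeDeriv φ z.1 z.2 = 0 := fun z hz =>
    IsSpaceTimeTestOn.timeDeriv_eq_zero_of_notMem hz
  have hLK : ∀ z ∉ K, Δ (φ z.1) z.2 = 0 := fun z hz =>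
    laplacian_eq_zero_of_notMem_tsupport (notMem_tsupport_slice hz)
  -- the integrable pieces
  set R : ℝ × E → ℝ := fun z => ‖u z.1 z.2‖ ^ 2 * (timeDeriv φ z.1 z.2 + ν * Δ (φ z.1) z.2) +
      (‖u z.1 z.2‖ ^ 2 + 2 * p z.1 z.2) * ⟪u z.1 z.2, gradient (φ z.1) z.2⟫ +
      2 * ⟪f z.1 z.2, u z.1 z.2⟫ * φ z.1 z.2 with hR
  set W : ℝ × E → ℝ := fun z => ‖u z.1 z.2‖ ^ 2 * φ z.1 z.2 with hW
  set F₀ : ℝ × E → ℝ := fun z => frobeniusNormSq (G₀ z.1 z.2) * φ z.1 z.2 with hF₀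
  have hu2 : LocallyIntegrableOn (fun z : ℝ × E => ‖u z.1 z.2‖ ^ 2) (Q : Set (ℝ × E)) volume :=
    h.distributional.2.1
  have hIW : Integrable W (volume : Measure (ℝ × E)) :=
    integrable_mul_of_locallyIntegrableOn hu2 hcφ hKc hKQ hφK
  have hIF : Integrable F₀ (volume : Measure (ℝ × E)) :=
    integrable_mul_of_locallyIntegrableOn (locallyIntegrableOn_frobeniusNormSq hG₀ hG₀2) hcφ
      hKc hKQ hφK
  have hIR : Integrable R (volume : Measure (ℝ × E)) := by
    have h1 : Integrable (fun z : ℝ × E =>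
        ‖u z.1 z.2‖ ^ 2 * (timeDeriv φ z.1 z.2 + ν * Δ (φ z.1) z.2)) (volume : Measure (ℝ × E)) :=
      integrable_mul_of_locallyIntegrableOn hu2 (hcT.add (continuous_const.mul hcL)) hKc hKQ
        fun z hz => by rw [hTK z hz, hLK z hz]; ring
    have h2 : Integrable (fun z : ℝ × E =>
        ⟪(fun t x => (‖u t x‖ ^ 2 + 2 * p t x) • u t x) z.1 z.2, gradient (φ z.1) z.2⟫)
        (volume : Measure (ℝ × E)) :=
      integrable_inner_of_locallyIntegrableOn (h.locallyIntegrableOn_cubic hu3) hcg hKc hKQ hg0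
    have h3 : Integrable (fun z : ℝ × E => ⟪f z.1 z.2, u z.1 z.2⟫ * (2 * φ z.1 z.2))
        (volume : Measure (ℝ × E)) :=
      integrable_mul_of_locallyIntegrableOn hfu (continuous_const.mul hcφ) hKc hKQ
        fun z hz => by rw [hφK z hz, mul_zero]
    refine ((h1.add h2).add h3).congr (Eventually.of_forall fun z => ?_)
    simp only [hR, real_inner_smul_left, Pi.add_apply]
    ring
  -- Lebesgue points of `U(t) = ∫ |u(t)|² φ(t) dx`
  set U : ℝ → ℝ := fun t => ∫ x, W (t, x) with hU
  have hIU : Integrable U (volume : Measure ℝ) := hIW.integral_prod_left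
  have hLeb := IsUnifLocDoublingMeasure.ae_tendsto_average_norm_sub (μ := (volume : Measure ℝ))
    hIU.locallyIntegrable 2
  -- cut-offs and a.e. uniqueness of the weak gradient
  obtain ⟨C, -, hcut⟩ := exists_time_cutoff
  have hGG : ∀ᵐ z ∂(volume : Measure (ℝ × E)), z ∈ (Q : Set (ℝ × E)) →
      uncurry G z = uncurry G₀ z :=
    (ae_restrict_iff' Q.isOpen.measurableSet).1 (hG.ae_eq hG₀)
  have hmeasS : ∀ s : ℝ, MeasurableSet {z : ℝ × E | z.1 < s} := fun s =>
    measurableSet_lt measurable_fst measurable_const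
  filter_upwards [hLeb] with s hs
  -- the cut-off sequence at `s`
  set ε : ℕ → ℝ := fun n => 1 / ((n : ℝ) + 1) with hε
  have hεpos : ∀ n, 0 < ε n := fun n => Nat.one_div_pos_of_nat
  have hε0 : Tendsto ε atTop (𝓝 0) := tendsto_one_div_add_atTop_nhds_zero_nat
  choose η k hηs hη01 hη1 hη0 hηd hkc hkb hks hk1 using fun n => hcut s (ε n) (hεpos n)
  have hηc : ∀ n, Continuous fun z : ℝ × E => η n z.1 := fun n =>
    (hηs n).continuous.comp continuous_fst
  have hηb : ∀ n (z : ℝ × E), ‖η n z.1‖ ≤ 1 := fun n z => by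
    rw [Real.norm_eq_abs, abs_of_nonneg (hη01 n z.1).1]; exact (hη01 n z.1).2
  have hint1 : ∀ n, Integrable (fun z : ℝ × E => η n z.1 * F₀ z) (volume : Measure (ℝ × E)) :=
    fun n => hIF.bdd_mul (hηc n).aestronglyMeasurable (Eventually.of_forall (hηb n))
  have hint2 : ∀ n, Integrable (fun z : ℝ × E => η n z.1 * R z) (volume : Measure (ℝ × E)) :=
    fun n => hIR.bdd_mul (hηc n).aestronglyMeasurable (Eventually.of_forall (hηb n))
  have hint3 : ∀ n, Integrable (fun z : ℝ × E => k n z.1 * W z) (volume : Measure (ℝ × E)) :=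
    fun n => hIW.bdd_mul ((hkc n).comp continuous_fst).aestronglyMeasurable
      (Eventually.of_forall fun z => by rw [Real.norm_eq_abs]; exact hkb n z.1)
  -- the local energy inequality for `ηₙ φ`
  have hstep : ∀ n, (∫ t, k n t * U t) + 2 * ν * ∫ z, η n z.1 * F₀ z ≤ ∫ z, η n z.1 * R z := by
    intro n
    have hΦ : IsSpaceTimeTestOn Q (fun t x => η n t * φ t x) := hφ.time_mul (hηs n)
    have hΦ0 : ∀ t x, 0 ≤ η n t * φ t x := fun t x => mul_nonneg (hη01 n t).1 (hφ0 t x)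
    have hL := hLEI _ hΦ hΦ0
    -- derivatives of the product
    have hT : ∀ t x, timeDeriv (fun t x => η n t * φ t x) t x =
        η n t * timeDeriv φ t x - k n t * φ t x := by
      intro t x
      have hd : HasDerivAt (fun s => η n s * φ s x)
          (-k n t * φ t x + η n t * timeDeriv φ t x) t :=
        (hηd n t).mul (hφ.hasDerivAt_time t x)
      rw [timeDeriv, hd.deriv]
      ring
    have hLap : ∀ t x, Δ ((fun t x => η n t * φ t x) t) x = η n t * Δ (φ t) x := by
      intro t x
      have e : (fun x => η n t * φ t x) = (η n t) • (φ t) := by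
        funext y; simp only [Pi.smul_apply, smul_eq_mul]
      have h2 : ContDiffAt ℝ 2 (φ t) x := (contDiff_infty.1 (hφ.contDiff_slice t) 2).contDiffAt
      show Δ (fun x => η n t * φ t x) x = _
      rw [e, InnerProductSpace.laplacian_smul _ h2, smul_eq_mul]
    have hgr : ∀ t x, gradient ((fun t x => η n t * φ t x) t) x = η n t • gradient (φ t) x := by
      intro t x
      have hd : DifferentiableAt ℝ (φ t) x :=
        ((hφ.contDiff_slice t).differentiable (by simp)).differentiableAt
      show gradient (fun x => η n t * φ t x) x = _
      rw [gradient, gradient, fderiv_const_mul hd, map_smul]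
    simp only [hT, hLap, hgr, real_inner_smul_right] at hL
    -- both sides as integrals over `ℝ × E`
    have e1 : (∫ t, ∫ x, frobeniusNormSq (G₀ t x) * (η n t * φ t x)) = ∫ z, η n z.1 * F₀ z := by
      rw [Measure.volume_eq_prod, integral_prod _ (hint1 n)]
      refine integral_congr_ae (Eventually.of_forall fun t => integral_congr_ae
        (Eventually.of_forall fun x => ?_))
      simp only [hF₀]; ring
    have e2 : (∫ t, ∫ x, (‖u t x‖ ^ 2 * (η n t * timeDeriv φ t x - k n t * φ t x +
          ν * (η n t * Δ (φ t) x)) +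
        (‖u t x‖ ^ 2 + 2 * p t x) * (η n t * ⟪u t x, gradient (φ t) x⟫) +
        2 * ⟪f t x, u t x⟫ * (η n t * φ t x))) =
        (∫ z, η n z.1 * R z) - ∫ z, k n z.1 * W z := by
      have hsub : Integrable (fun z : ℝ × E => η n z.1 * R z - k n z.1 * W z)
          (volume : Measure (ℝ × E)) := (hint2 n).sub (hint3 n)
      rw [← integral_sub (hint2 n) (hint3 n), Measure.volume_eq_prod,
        integral_prod (fun z : ℝ × E => η n z.1 * R z - k n z.1 * W z) hsub]
      refine integral_congr_ae (Eventually.of_forall fun t => integral_congr_ae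
        (Eventually.of_forall fun x => ?_))
      simp only [hR, hW]; ring
    have e3 : ∫ z, k n z.1 * W z = ∫ t, k n t * U t := by
      rw [Measure.volume_eq_prod, integral_prod _ (hint3 n)]
      refine integral_congr_ae (Eventually.of_forall fun t => ?_)
      simp only [hU, ← integral_const_mul]
    rw [e1, e2, e3] at hL
    linarith
  -- the three limits
  have hlimR : Tendsto (fun n => ∫ z, η n z.1 * R z) atTop (𝓝 (∫ z in {z : ℝ × E | z.1 < s}, R z)) := by
    rw [← integral_indicator (hmeasS s)]
    refine tendsto_integral_of_dominated_convergence (fun z => ‖R z‖)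
      (fun n => (hint2 n).aestronglyMeasurable) hIR.norm
      (fun n => Eventually.of_forall fun z => ?_) (Eventually.of_forall fun z => ?_)
    · rw [norm_mul]
      exact mul_le_of_le_one_left (norm_nonneg _) (hηb n z)
    · have := (tendsto_cutoff_indicator hεpos hε0 (hη1) (hη0) z.1).mul_const (R z)
      refine this.congr' (Eventually.of_forall fun n => rfl) |>.trans ?_
      by_cases hz : z.1 < s
      · rw [indicator_of_mem (mem_Iio.2 hz), indicator_of_mem (show z ∈ {z : ℝ × E | z.1 < s} from hz),
          one_mul]
      · rw [indicator_of_notMem (fun h' => hz (mem_Iio.1 h')),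
          indicator_of_notMem (show z ∉ {z : ℝ × E | z.1 < s} from hz), zero_mul]
  have hlimF : Tendsto (fun n => ∫ z, η n z.1 * F₀ z) atTop
      (𝓝 (∫ z in {z : ℝ × E | z.1 < s}, F₀ z)) := by
    rw [← integral_indicator (hmeasS s)]
    refine tendsto_integral_of_dominated_convergence (fun z => ‖F₀ z‖)
      (fun n => (hint1 n).aestronglyMeasurable) hIF.norm
      (fun n => Eventually.of_forall fun z => ?_) (Eventually.of_forall fun z => ?_)
    · rw [norm_mul]
      exact mul_le_of_le_one_left (norm_nonneg _) (hηb n z)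
    · have := (tendsto_cutoff_indicator hεpos hε0 (hη1) (hη0) z.1).mul_const (F₀ z)
      refine this.congr' (Eventually.of_forall fun n => rfl) |>.trans ?_
      by_cases hz : z.1 < s
      · rw [indicator_of_mem (mem_Iio.2 hz), indicator_of_mem (show z ∈ {z : ℝ × E | z.1 < s} from hz),
          one_mul]
      · rw [indicator_of_notMem (fun h' => hz (mem_Iio.1 h')),
          indicator_of_notMem (show z ∉ {z : ℝ × E | z.1 < s} from hz), zero_mul]
  have hlimU : Tendsto (fun n => ∫ t, k n t * U t) atTop (𝓝 (U s)) :=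
    tendsto_integral_kernel_mul_of_lebesguePoint hIU (fun w δ hδ hm => hs w δ hδ hm) hεpos hε0
      hkc hkb hks hk1
  -- pass to the limit
  have hfinal : U s + 2 * ν * ∫ z in {z : ℝ × E | z.1 < s}, F₀ z ≤
      ∫ z in {z : ℝ × E | z.1 < s}, R z :=
    le_of_tendsto_of_tendsto' (hlimU.add (hlimF.const_mul (2 * ν))) hlimR hstep
  -- replace `G₀` by `G`
  have hGint : ∫ z in {z : ℝ × E | z.1 < s}, frobeniusNormSq (G z.1 z.2) * φ z.1 z.2 =
      ∫ z in {z : ℝ × E | z.1 < s}, F₀ z := by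
    refine integral_congr_ae ((ae_restrict_of_ae hGG).mono fun z hz => ?_)
    by_cases hzQ : z ∈ (Q : Set (ℝ × E))
    · have e : G z.1 z.2 = G₀ z.1 z.2 := hz hzQ
      simp only [hF₀, e]
    · simp only [hF₀, hφK z (fun hzK => hzQ (hKQ hzK)), mul_zero]
  rw [hGint]
  exact hfinal

end Slice

end Literature.Analysis.FluidPDE
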